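import Mathlib
import HarnessLib
import Literature.Analysis.FluidPDE.ClassicalSolution
import Literature.Analysis.FluidPDE.SuitableWeak

/-!
# Shelf 1574, LINE 9 «trace_transfer»: STUB 5 (glue) — a backward-singular vertex forbids a smooth
# extension past the lifespan

Helper file (`--supports stmt-NavierStokesRegularity-1574 --as helper`) for the banked line
`Cruxes/EnstrophyQuarterLaw/Lines/trace_transfer.lean` (ns-idea-9 g4, LINE 9; idea-crit-8 V35
PASS-WITH-PRICE «corollary grade»; KEY-NS #131 (1): typed cross-route edge 1574 ⇒ 18384/18385). The
statement is the line's registered `stub_not_hasSmoothExtensionPast_of_backwardSingular` VERBATIM (size S):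
if `u` is classical on `[0, T) × ℝ³` and essentially unbounded on EVERY backward parabolic cylinder
`Q_r(T, x₀)`, then `u` has no smooth extension past `T`.

PROOF: an extension `u'` is classical on `[0, T') × ℝ³`, `T' > T`, hence continuous, hence bounded on the
compact set `[0, T] × B̄(x₀, √T) ⊆ [0, T') × ℝ³`; the cylinder `Q_{√T}(T, x₀) = (0, T) × B(x₀, √T)` lies
inside it and there `u = u'`; so `u` is essentially bounded on that cylinder — contradiction.

No summit statement is proved: `EnstrophyQuarterLaw` (1574), `TraceScarL3` (18384), `TypeITraceScarL3`
(18385) stay OPEN; this is glue only.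
-/

noncomputable section

-- the summit-side namespace repeats a component by design (D-0017)
set_option linter.dupNamespace false

namespace Summit.NavierStokesRegularity.NavierStokesRegularity.Theorems.EnstrophyQuarterLaw.TraceTransfer

open Set MeasureTheory Function Metric
open scoped ENNReal NNReal
open Literature.Analysis.FluidPDE

/-- **STUB 5 of LINE 9 «trace_transfer» (glue), registered signature verbatim.** For `ν > 0`, `T > 0` and a
classical solution `(u, p)` of the unforced Navier–Stokes system on `[0, T) × ℝ³`: if at `x₀` the velocity is
essentially unbounded on every backward parabolic cylinder `Q_r(T, x₀)`, `r > 0`, then `u` admits no smooth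
extension past `T` (an extension would be continuous, hence bounded, on the compact closure of
`Q_{√T}(T, x₀)`). [folklore] -/
theorem stub_not_hasSmoothExtensionPast_of_backwardSingular :
    ∀ (ν T : ℝ), 0 < ν → 0 < T →
      ∀ (u : ℝ → EuclideanSpace ℝ (Fin 3) → EuclideanSpace ℝ (Fin 3)) (p : ℝ → EuclideanSpace ℝ (Fin 3) → ℝ),
        IsClassicalNSSolutionOn (Set.Ico 0 T) ν 0 u p → ∀ x₀ : EuclideanSpace ℝ (Fin 3),
        (∀ r : ℝ, 0 < r →
          eLpNorm (uncurry u) ⊤ (volume.restrict (parabolicCylinder r (T, x₀))) = ⊤) →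
        ¬ HasSmoothExtensionPast ν 0 u T := by
  intro ν T _hν hT u p _hcl x₀ hsing hext
  obtain ⟨T', hT', u', p', hcl', hagree⟩ := hext
  -- the radius `r = √T`: `Q_r(T, x₀) = (0, T) × B(x₀, r)`
  set r : ℝ := Real.sqrt T with hr_def
  have hr : 0 < r := Real.sqrt_pos.2 hT
  have hr2 : r ^ 2 = T := Real.sq_sqrt hT.le
  -- the extension is continuous, hence bounded, on the compact `[0, T] × B̄(x₀, r)`
  set K : Set (ℝ × EuclideanSpace ℝ (Fin 3)) := Icc 0 T ×ˢ closedBall x₀ r with hK_def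
  have hK : IsCompact K := isCompact_Icc.prod (isCompact_closedBall _ _)
  have hKsub : K ⊆ Ico 0 T' ×ˢ (univ : Set (EuclideanSpace ℝ (Fin 3))) :=
    prod_mono (Icc_subset_Ico_right hT') (subset_univ _)
  have hcont : ContinuousOn (uncurry u') K := hcl'.smooth_velocity.continuousOn.mono hKsub
  obtain ⟨C, hC⟩ := hK.exists_bound_of_continuousOn hcont
  -- on the cylinder `u = u'` and the bound holds pointwise
  have hQK : parabolicCylinder r ((T : ℝ), x₀) ⊆ K := by
    intro z hz
    rw [mem_parabolicCylinder] at hz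
    refine ⟨⟨by linarith [hz.1.1], hz.1.2.le⟩, ?_⟩
    exact mem_closedBall.2 (le_of_lt (mem_ball.1 hz.2))
  have hbound : ∀ z ∈ parabolicCylinder r ((T : ℝ), x₀), ‖uncurry u z‖ ≤ C := by
    intro z hz
    have hzK := hQK hz
    rw [mem_parabolicCylinder] at hz
    have ht : z.1 ∈ Ico 0 T := ⟨by linarith [hz.1.1], hz.1.2⟩
    have e : uncurry u z = uncurry u' z := by
      simp only [uncurry]
      rw [hagree z.1 ht]
    rw [e]
    exact hC z hzK
  -- hence `u` is essentially bounded on `Q_r(T, x₀)` — contradicting the singular vertex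
  have hlt : eLpNorm (uncurry u) ⊤ (volume.restrict (parabolicCylinder r ((T : ℝ), x₀))) < ⊤ := by
    rw [eLpNorm_exponent_top]
    exact eLpNormEssSup_lt_top_of_ae_bound
      ((ae_restrict_mem (isOpen_parabolicCylinder _ _).measurableSet).mono hbound)
  exact hlt.ne (hsing r hr)

end Summit.NavierStokesRegularity.NavierStokesRegularity.Theorems.EnstrophyQuarterLaw.TraceTransfer

end
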